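import Summits.CriticalPhenomena.CardyFormulaZ2.Theorems.CardyUniqueLimitCardyRigidityFaceHalfPlaneG2OfTransfer
import HarnessLib

/-!
# The ORIENTED annulus-transfer input and Condition G2 in `ℍ` (line `crossing-martingale`, stub A2‴ reshaped)

Crux `Summit.CriticalPhenomena.CardyFormulaZ2.Theses.CardyUniqueLimit.CardyRigidity`
(stmt-CriticalPhenomena-0746), line `crossing_martingale`, lead c3.  The worker of stub A2‴
`stub_percFaceAnnulusTransfer : Driver.PercFaceAnnulusTransfer` (`…FaceHalfPlaneG2OfTransfer.lean`)
reported it MIS-STATED: as registered the predicate also quantifies over discretisation families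
whose interface is the time-REVERSED native exploration at every small mesh (endpoint rule
`orientCurve`; e.g. the counter-clockwise unit-disc data, cf. `…OrientedDisc.lean`), for which the
Loewner past is a SUFFIX of `medialExploration` and none of the tree's prefix machinery
(`explorationCylinder`, `revealedFreeEdges`, `FKInterfaceDrivingLocality`, all under an orientation
hypothesis) applies.  The line only ever uses ORIENTED families (the hypothesis `hOr` of
`crossingMartingale_of_stubs`, `hor` of `PercCapacityClockH`, `OrientedDisc.exists_oriented_family`),
so the reshape threads the orientation clause

    (∀ᶠ k in atTop, ∀ ω, _root_.Literature.Probability.Percolation.bondInterfaceIn D (Λ (δs k)) ω = CurveClass.mk ⟨medialExplorationCurve (Λ (δs k)) ω⟩) →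

through the two predicates of the G2 layer:

* `Driver.PercFaceAnnulusTransferOr` — `Driver.PercFaceAnnulusTransfer` with the clause inserted after
  (U2) (the NEW registered stub A2‴ `stub_percFaceAnnulusTransferOr`);
* `Driver.PercFaceHalfPlaneG2Or` — `Driver.PercFaceHalfPlaneG2` with the same clause;
* `Driver.percFaceHalfPlaneG2Or_of_annulusTransferOr` — the probabilistic half (verbatim the landed
  proof of `Driver.percFaceHalfPlaneG2_of_annulusTransfer`, the clause passed through).

The tail bridge with the clause (`limitTail_of_face`, `percDrivingTail_of_face` oriented) is the
companion file `…PercDrivingTailOfFaceOr.lean`.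

References: A. Kemppainen, S. Smirnov, Ann. Probab. 45 (2017) 698–779, §2.1.3, §2.2 (Prop. 2.6),
§4.1.4, §4.2 (Prop. 4.7, Remark 4.8).
(buildfix 2026-08-20: comment-only re-land to re-enqueue the module build after its blocking imports were repaired; no declaration changed.)
-/

noncomputable section

open MeasureTheory Filter Set Topology Metric
open scoped NNReal ENNReal unitInterval
open UpperHalfPlane (upperHalfPlaneSet)
open Literature.Probability Literature.Probability.RandomPlanarGeometry
  Literature.Probability.LatticeModels Literature.Probability.Percolation
open scoped Literature.Probability.RandomPlanarGeometry.PathBorel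

namespace Summit.CriticalPhenomena.CardyFormulaZ2.Cruxes.CardyRigidity.CrossingMartingale

namespace Driver

/-! ### The oriented annulus-transfer input -/

/-- **The annulus-transfer input for Condition G2 in `ℍ` of the face-domain system, ORIENTED form**:
verbatim `Driver.PercFaceAnnulusTransfer` (the deterministic half (T1)–(T3) of Kemppainen–Smirnov's
verification of Condition G2 for percolation read in `ℍ`: round annulus above the lattice scale,
countable-valued discrete past with determined fibres, fresh open-or-dual arm off the revealed
edges), restricted to meshes along which the interface IS the class of the native medial
exploration polyline (the orientation clause, inserted after (U2)).  A sub-goal PREDICATE of the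
crux (the reshaped stub A2‴; Kemppainen–Smirnov 2017, Prop. 2.6, §2.2, §4.1.4, §4.2), deliberately
not a cited Literature fact. -/
def PercFaceAnnulusTransferOr : Prop :=
  ∃ c₁ : ℝ, 0 < c₁ ∧ ∀ C' : ℝ, ∃ C : ℝ, 1 < C ∧
  ∀ (D : DobrushinDomain) (Λ : ℝ → DiscreteDobrushin) (hΛ : ZdDiscretisationFamily D Λ)
    (φ : ConformalEquiv upperHalfPlaneSet D.carrier), D.IsChordalUniformizing φ →
    ∀ (δs : ℕ → ℝ), (∀ k, 0 < δs k) → Tendsto δs atTop (𝓝 0) →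
    ∀ (hadm : ∀ k, (Λ (δs k)).IsZdAdmissible)
      (φs : ∀ k, ConformalEquiv upperHalfPlaneSet (orientedFaceDomain hΛ (hadm k)).carrier),
      (∀ k, (orientedFaceDomain hΛ (hadm k)).IsChordalUniformizing (φs k)) →
      (∀ R : ℝ, TendstoUniformlyOn (fun k ↦ (φs k).boundaryExtension) φ.boundaryExtension
        atTop ({z : ℂ | 0 ≤ z.im} ∩ closedBall 0 R)) →
      (∀ ε : ℝ, 0 < ε → ∃ r : ℝ, ∀ᶠ k in atTop, ∀ z : ℂ, z ∈ {z : ℂ | 0 ≤ z.im} → r ≤ ‖z‖ →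
        dist ((φs k).boundaryExtension z) ((orientedFaceDomain hΛ (hadm k)).pt 1) ≤ ε) →
      (∀ᶠ k in atTop, ∀ ω, _root_.Literature.Probability.Percolation.bondInterfaceIn D (Λ (δs k)) ω =
        CurveClass.mk ⟨medialExplorationCurve (Λ (δs k)) ω⟩) →
      ∀ u : ℝ≥0, 0 < u → ∀ Z : ℝ, ∀ᶠ k in atTop,
        ∀ F : Set ℂ, IsClosed F → F.Nonempty → ∀ z₀ : ℝ, |z₀| ≤ Z →
          ∃ (x : ℂ) (ρ ρ' : ℝ), c₁ * δs k ≤ ρ ∧ C' * ρ ≤ ρ' ∧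
          ∃ (κ : Type) (_ : Countable κ) (pref : BondConfig (Site 2) → κ)
            (Rev : κ → Set (Sym2 (Site 2))),
            (∀ d, MeasurableSet (pref ⁻¹' {d})) ∧
            (∀ d, DeterminedBy (pref ⁻¹' {d}) (Rev d)) ∧
            ∀ (ω : BondConfig (Site 2)) (p : C(ℝ≥0, ℂ) × C(ℝ≥0, ℝ)), p ∈ generatedPairs →
              p.1 0 = 0 → p.2 0 = 0 →
              _root_.Literature.Probability.Percolation.bondInterfaceIn D (Λ (δs k)) ω =
                compactifiedClass (φs k).boundaryExtension
                  ((orientedFaceDomain hΛ (hadm k)).pt 1) p.1 →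
              drivingFunction (φs k) (_root_.Literature.Probability.Percolation.bondInterfaceIn D (Λ (δs k)) ω) = p.2 →
              (∀ (ω' : BondConfig (Site 2)) (p' : C(ℝ≥0, ℂ) × C(ℝ≥0, ℝ)), p' ∈ generatedPairs →
                  p'.1 0 = 0 → p'.2 0 = 0 →
                  _root_.Literature.Probability.Percolation.bondInterfaceIn D (Λ (δs k)) ω' =
                    compactifiedClass (φs k).boundaryExtension
                      ((orientedFaceDomain hΛ (hadm k)).pt 1) p'.1 →
                  drivingFunction (φs k) (_root_.Literature.Probability.Percolation.bondInterfaceIn D (Λ (δs k)) ω') = p'.2 →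
                  pref ω = pref ω' →
                  CurveClass.stopAt F (headClass p.1 u) = CurveClass.stopAt F (headClass p'.1 u)) ∧
              (Disjoint (CurveClass.stopAt F (headClass p.1 u)).range
                  (ball ((z₀ : ℝ) : ℂ) (C * (2 * Real.sqrt u))) →
                (headClass p.1 u).startFrom F ∈ CurveClass.crossingIn ((z₀ : ℝ) : ℂ)
                  (2 * Real.sqrt u) (C * (2 * Real.sqrt u)) univ →
                ω ∈ annulusOpenCrossingOff (Rev (pref ω)) x (δs k) ρ ρ' ∪
                  annulusDualCrossingOff (Rev (pref ω)) x (δs k) ρ ρ')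

/-! ### Condition G2 in `ℍ`, oriented form -/

/-- **Condition G2 in `ℍ` for the bond-`ℤ²` interfaces in the oriented face domains, ORIENTED form**:
verbatim `Driver.PercFaceHalfPlaneG2` (one ratio `C > 1`; for the KS binder block with box tightness,
every capacity horizon `u > 0` and bound `Z`, eventually in `k`, a measurable choice of the
capacity-`u` head of the Loewner trace whose law satisfies the unforced-crossing bound
`P(stopAt F ∈ S ∧ startFrom F crosses A(z₀, 2√u, 2C√u)) ≤ ½ P(stopAt F ∈ S)` for pasts `S`
avoiding the outer disc), restricted by the orientation clause inserted after (U2).  A sub-goal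
PREDICATE of the crux (Kemppainen–Smirnov 2017, §2.1.3, §2.2, Prop. 3.7), deliberately not a cited
Literature fact. -/
def PercFaceHalfPlaneG2Or : Prop :=
  ∃ C : ℝ, 1 < C ∧
  ∀ (D : DobrushinDomain) (Λ : ℝ → DiscreteDobrushin) (hΛ : ZdDiscretisationFamily D Λ)
    (φ : ConformalEquiv upperHalfPlaneSet D.carrier), D.IsChordalUniformizing φ →
    ∀ (δs : ℕ → ℝ), (∀ k, 0 < δs k) → Tendsto δs atTop (𝓝 0) →
    ∀ (hadm : ∀ k, (Λ (δs k)).IsZdAdmissible)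
      (φs : ∀ k, ConformalEquiv upperHalfPlaneSet (orientedFaceDomain hΛ (hadm k)).carrier),
      (∀ k, (orientedFaceDomain hΛ (hadm k)).IsChordalUniformizing (φs k)) →
      (∀ R : ℝ, TendstoUniformlyOn (fun k ↦ (φs k).boundaryExtension) φ.boundaryExtension
        atTop ({z : ℂ | 0 ≤ z.im} ∩ closedBall 0 R)) →
      (∀ ε : ℝ, 0 < ε → ∃ r : ℝ, ∀ᶠ k in atTop, ∀ z : ℂ, z ∈ {z : ℂ | 0 ≤ z.im} → r ≤ ‖z‖ →
        dist ((φs k).boundaryExtension z) ((orientedFaceDomain hΛ (hadm k)).pt 1) ≤ ε) →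
      (∀ᶠ k in atTop, ∀ ω, _root_.Literature.Probability.Percolation.bondInterfaceIn D (Λ (δs k)) ω =
        CurveClass.mk ⟨medialExplorationCurve (Λ (δs k)) ω⟩) →
      (∀ ε : ℝ≥0∞, 0 < ε → ∃ (δγ δW : ℕ → ℝ) (T : ℕ → ℝ≥0), (∀ j, 0 < δγ j) ∧
        (∀ j, 0 < δW j) ∧
        ∀ k, bondPercolation (zdGraph 2) half ((_root_.Literature.Probability.Percolation.bondInterfaceIn D (Λ (δs k))) ⁻¹'
          ((fun p ↦ compactifiedClass (φs k).boundaryExtension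
              ((orientedFaceDomain hΛ (hadm k)).pt 1) p.1) ''
            {p : C(ℝ≥0, ℂ) × C(ℝ≥0, ℝ) | p ∈ generatedPairs ∧
              p.1 ∈ Process.modulusSet ({0} : Set ℂ) δγ ∧
              p.2 ∈ Process.modulusSet ({0} : Set ℝ) δW ∧
              ∀ (j : ℕ) (t : ℝ≥0), T j ≤ t → (j : ℝ) ≤ ‖p.1 t‖})ᶜ) ≤ ε) →
      ∀ u : ℝ≥0, 0 < u → ∀ Z : ℝ, ∀ᶠ k in atTop,
        ∃ crv : BondConfig (Site 2) → CurveClass ℂ,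
          AEMeasurable crv (bondPercolation (zdGraph 2) half) ∧
          (∀ᵐ ω ∂bondPercolation (zdGraph 2) half, (crv ω).source = 0 ∧
            (crv ω).range = (Loewner.trace
              (drivingFunction (φs k) (_root_.Literature.Probability.Percolation.bondInterfaceIn D (Λ (δs k)) ω))) '' Icc 0 u) ∧
          ∀ F : Set ℂ, IsClosed F → F.Nonempty → ∀ z₀ : ℝ, |z₀| ≤ Z →
            ∀ S : Set (CurveClass ℂ), MeasurableSet S →
            S ⊆ {p | Disjoint p.range (ball ((z₀ : ℝ) : ℂ) (C * (2 * Real.sqrt u)))} →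
            (bondPercolation (zdGraph 2) half).map crv (CurveClass.stopAt F ⁻¹' S ∩
                {c | c.startFrom F ∈ CurveClass.crossingIn ((z₀ : ℝ) : ℂ) (2 * Real.sqrt u)
                  (C * (2 * Real.sqrt u)) univ}) ≤
              2⁻¹ * (bondPercolation (zdGraph 2) half).map crv (CurveClass.stopAt F ⁻¹' S)

/-! ### Condition G2 in `ℍ` (oriented) from the oriented transfer input -/

-- adapted from Theorems/CardyUniqueLimitCardyRigidityFaceHalfPlaneG2OfTransfer.lean
-- (`Driver.percFaceHalfPlaneG2_of_annulusTransfer`), orientation clause threaded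
/-- **Condition G2 in `ℍ` for the face-domain system (oriented form) from the oriented
annulus-transfer input** (Kemppainen–Smirnov's Prop. 4.7 / Remark 4.8 read in `ℍ` through the
chordal maps of the oriented face domains, modulo the deterministic half): the ratio is the `C` that
the transfer input attaches to the RSW ratio of `exists_const_freshArm_le_half`; the curve classes
are the capacity-`u` heads of the Loewner traces (measurable with countable range, a.s. from `0` with
the right trace by `ae_exists_pair_of_boxTight`); the bound is the decoupling
`measure_preimage_inter_le_mul_of_freshArm` over the values of the discrete past on the a.s. set of
configurations carrying a Loewner pair.
[cite: KemppainenSmirnov2017, §4.2 Prop. 4.7 and Remark 4.8, §2.2 Prop. 2.6] -/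
theorem percFaceHalfPlaneG2Or_of_annulusTransferOr (hT : PercFaceAnnulusTransferOr) :
    PercFaceHalfPlaneG2Or := by
  obtain ⟨c₁, hc₁, hT⟩ := hT
  obtain ⟨Cp, -, -, hhalf⟩ := exists_const_freshArm_le_half 0 hc₁ le_rfl
  obtain ⟨C, hC, hT⟩ := hT Cp
  refine ⟨C, hC, ?_⟩
  intro D Λ hΛ φ hφ δs hpos hlim hadm φs hφs hU1 hU2 hor hbox u hu Z
  filter_upwards [hT D Λ hΛ φ hφ δs hpos hlim hadm φs hφs hU1 hU2 hor u hu Z] with k hk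
  set P : Measure (BondConfig (Site 2)) := bondPercolation (zdGraph 2) half with hP
  haveI : IsProbabilityMeasure P := by rw [hP]; infer_instance
  -- the a.s. Loewner pair behind the interface at scale `k`
  have hgood : ∀ᵐ ω ∂P, ∃ p : C(ℝ≥0, ℂ) × C(ℝ≥0, ℝ), p ∈ generatedPairs ∧ p.1 0 = 0 ∧
      p.2 0 = 0 ∧ _root_.Literature.Probability.Percolation.bondInterfaceIn D (Λ (δs k)) ω = compactifiedClass (φs k).boundaryExtension
        ((orientedFaceDomain hΛ (hadm k)).pt 1) p.1 ∧
      drivingFunction (φs k) (_root_.Literature.Probability.Percolation.bondInterfaceIn D (Λ (δs k)) ω) = p.2 :=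
    ae_exists_pair_of_boxTight P (hφs k) (_root_.Literature.Probability.Percolation.bondInterfaceIn D (Λ (δs k)))
      (fun ε hε ↦ (hbox ε hε).imp fun δγ ⟨δW, T, hδγ, hδW, hall⟩ ↦ ⟨δW, T, hδγ, hδW, hall k⟩)
  -- the candidate: the capacity-`u` head of the Loewner trace of the driving function
  obtain ⟨crv, hcrv⟩ : ∃ crv : BondConfig (Site 2) → CurveClass ℂ, ∀ ω, crv ω =
      headClassOfFun (Loewner.trace (drivingFunction (φs k) (_root_.Literature.Probability.Percolation.bondInterfaceIn D (Λ (δs k)) ω))) u :=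
    ⟨_, fun _ ↦ rfl⟩
  have hcrvG : ∀ (ω : BondConfig (Site 2)) (p : C(ℝ≥0, ℂ) × C(ℝ≥0, ℝ)), p ∈ generatedPairs →
      drivingFunction (φs k) (_root_.Literature.Probability.Percolation.bondInterfaceIn D (Λ (δs k)) ω) = p.2 → crv ω = headClass p.1 u := by
    intro ω p hp hW
    rw [hcrv, hW, Loewner.IsGeneratedByCurve.trace_eq_holds p.2.continuous hp, headClassOfFun_coe]
  have hfac : ∀ ω ω', medialExploration (Λ (δs k)) ω = medialExploration (Λ (δs k)) ω' →
      crv ω = crv ω' := fun ω ω' h ↦ by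
    rw [hcrv, hcrv, _root_.Literature.Probability.Percolation.bondInterfaceIn_apply, _root_.Literature.Probability.Percolation.bondInterfaceIn_apply, medialExplorationCurve_congr h]
  have hmeas : Measurable crv := measurable_of_medialExploration _ hfac
  have hcount : (Set.range crv).Countable := countable_range_of_medialExploration _ hfac
  refine ⟨crv, hmeas.aemeasurable, ?_, ?_⟩
  · -- a.s. source `0` and trace `γ̂[0, u]`
    filter_upwards [hgood] with ω hω
    obtain ⟨p, hp, hp1, -, -, hW⟩ := hω
    have htr : Loewner.trace (drivingFunction (φs k) (_root_.Literature.Probability.Percolation.bondInterfaceIn D (Λ (δs k)) ω)) = p.1 := by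
      rw [hW]; exact Loewner.IsGeneratedByCurve.trace_eq_holds p.2.continuous hp
    rw [hcrvG ω p hp hW, htr, source_headClass, range_headClass p.1 hu]
    exact ⟨hp1, rfl⟩
  · -- the crossing bound
    intro F hF hFne z₀ hz₀ S _ hSsub
    obtain ⟨x, ρ, ρ', hρ, hρ', κ, hκ, pref, Rev, hmeasd, hdet, hcl⟩ := hk F hF hFne z₀ hz₀
    -- the a.s. good set
    set G : Set (BondConfig (Site 2)) := {ω | ∃ p : C(ℝ≥0, ℂ) × C(ℝ≥0, ℝ), p ∈ generatedPairs ∧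
      p.1 0 = 0 ∧ p.2 0 = 0 ∧ _root_.Literature.Probability.Percolation.bondInterfaceIn D (Λ (δs k)) ω =
        compactifiedClass (φs k).boundaryExtension ((orientedFaceDomain hΛ (hadm k)).pt 1) p.1 ∧
      drivingFunction (φs k) (_root_.Literature.Probability.Percolation.bondInterfaceIn D (Λ (δs k)) ω) = p.2} with hG
    have hGae : ∀ᵐ ω ∂P, ω ∈ G := by
      filter_upwards [hgood] with ω hω
      exact hω
    have hGc : P Gᶜ = 0 := mem_ae_iff.1 hGae
    -- the events
    set X : Set (CurveClass ℂ) := {c | c.startFrom F ∈ CurveClass.crossingIn ((z₀ : ℝ) : ℂ)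
      (2 * Real.sqrt u) (C * (2 * Real.sqrt u)) univ} with hX
    set T : Set κ := {d | ∃ ω ∈ G, pref ω = d ∧ CurveClass.stopAt F (crv ω) ∈ S} with hTdef
    have h1 : crv ⁻¹' (CurveClass.stopAt F ⁻¹' S) ∩ G ⊆ pref ⁻¹' T :=
      fun ω ⟨hω, hωG⟩ ↦ ⟨ω, hωG, rfl, hω⟩
    have h2 : pref ⁻¹' T ∩ G ⊆ crv ⁻¹' (CurveClass.stopAt F ⁻¹' S) := by
      rintro ω ⟨⟨ω₁, hω₁G, hpref, hS₁⟩, hωG⟩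
      obtain ⟨p, hp, hp1, hp2, hYp, hWp⟩ := hωG
      obtain ⟨p₁, hp₁, hp₁1, hp₁2, hYp₁, hWp₁⟩ := hω₁G
      have key := (hcl ω p hp hp1 hp2 hYp hWp).1 ω₁ p₁ hp₁ hp₁1 hp₁2 hYp₁ hWp₁ hpref.symm
      change CurveClass.stopAt F (crv ω) ∈ S
      rw [hcrvG ω p hp hWp, key, ← hcrvG ω₁ p₁ hp₁ hWp₁]
      exact hS₁
    have hE : ∀ ω ∈ crv ⁻¹' X ∩ G ∩ crv ⁻¹' (CurveClass.stopAt F ⁻¹' S), pref ω ∈ T →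
        ω ∈ annulusOpenCrossingOff (Rev (pref ω)) x (δs k) ρ ρ' ∪
          annulusDualCrossingOff (Rev (pref ω)) x (δs k) ρ ρ' := by
      rintro ω ⟨⟨hωX, hωG⟩, hωS⟩ -
      obtain ⟨p, hp, hp1, hp2, hYp, hWp⟩ := hωG
      have hc := hcrvG ω p hp hWp
      refine (hcl ω p hp hp1 hp2 hYp hWp).2 ?_ ?_
      · rw [← hc]; exact hSsub hωS
      · rw [← hc]; exact hωX
    have hc : ∀ S' : Set (Sym2 (Site 2)), P (annulusOpenCrossingOff S' x (δs k) ρ ρ' ∪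
        annulusDualCrossingOff S' x (δs k) ρ ρ') ≤ 2⁻¹ := fun S' ↦ by
      simpa only [one_mul, div_one] using hhalf S' x (δs k) ρ ρ' (hpos k) hρ hρ'
    haveI : Countable κ := hκ
    calc P.map crv (CurveClass.stopAt F ⁻¹' S ∩ X)
        = P (crv ⁻¹' (CurveClass.stopAt F ⁻¹' S ∩ X)) := map_apply_of_countable_range hmeas hcount _
      _ = P (crv ⁻¹' (CurveClass.stopAt F ⁻¹' S ∩ X) ∩ G) := (measure_inter_conull hGc).symm
      _ ≤ P (pref ⁻¹' T ∩ (crv ⁻¹' X ∩ G ∩ crv ⁻¹' (CurveClass.stopAt F ⁻¹' S))) :=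
          measure_mono (by
            rintro ω ⟨⟨hS', hX'⟩, hG'⟩
            exact ⟨h1 ⟨hS', hG'⟩, ⟨hX', hG'⟩, hS'⟩)
      _ ≤ 2⁻¹ * P (pref ⁻¹' T) :=
          measure_preimage_inter_le_mul_of_freshArm (hpos k) pref Rev hmeasd hdet hE hc
      _ = 2⁻¹ * P (pref ⁻¹' T ∩ G) := by rw [measure_inter_conull hGc]
      _ ≤ 2⁻¹ * P (crv ⁻¹' (CurveClass.stopAt F ⁻¹' S)) := mul_le_mul_right (measure_mono h2) _
      _ = 2⁻¹ * P.map crv (CurveClass.stopAt F ⁻¹' S) := by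
          rw [map_apply_of_countable_range hmeas hcount]

end Driver

/-- **Registered-shape form** (glue of the reshaped stub A2‴ of stmt-CriticalPhenomena-0746): the
oriented annulus-transfer input `Driver.PercFaceAnnulusTransferOr` implies the oriented Condition G2
in `ℍ` `Driver.PercFaceHalfPlaneG2Or` for the bond-`ℤ²` interfaces in the oriented face domains.
[cite: KemppainenSmirnov2017, §4.2 Prop. 4.7 and Remark 4.8, §2.2 Prop. 2.6] -/
theorem faceG2Or_percFaceHalfPlaneG2Or_of_annulusTransferOr : Driver.PercFaceAnnulusTransferOr → Driver.PercFaceHalfPlaneG2Or :=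
  fun h ↦ Driver.percFaceHalfPlaneG2Or_of_annulusTransferOr h

end Summit.CriticalPhenomena.CardyFormulaZ2.Cruxes.CardyRigidity.CrossingMartingale

end
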